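import Literature.NumberTheory.Automorphic.ShimuraParametrizationSplitDegreeProofs
import Literature.NumberTheory.Automorphic.ShimuraCurveRibetTakahashiCokernelProofs
import HarnessLib

/-!
# Pasten 2024, Thm. 6.1 (b) from the finer printed inputs, with the `D = 1` bridge discharged

Topic `NumberTheory/Automorphic`; theorems only (no definition, no named fact, no instance;
D-0026). A small companion of `ShimuraCurveRibetTakahashiCokernelProofs.lean` (Pasten
§6.6–6.9 performed in the tree: Lemma 6.14 from the Eisenstein divisibility and Lemma 6.7,
Lemmas 6.15–6.16, Thm. 6.17, the telescoping of §6.9), whose finest assembly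
`PastenShimura2024_thm_6_1_b_of_ribetTakahashi_treeFacts` carried — like every assembly of
Pasten's Thm. 6.1 / 6.1 (b) in the tree — the hypothesis `h0`, "the `D = 1` bridge": on a
presentation `X : ShimuraCurveData 1 N` of `X₀(N)` the class-minimal Shimura degree divides the
newform-minimal classical degree `δ_{1,N}` (Pasten §2 p. 12: "`X₀^1(N) = X₀(N)`",
`δ_{1,N} = deg (q_{1,N} j_N)`). That bridge is now the tree's THEOREM
`ShimuraParametrizationData.IsMinimalFor.deg_dvd_modularDegree`
(`ShimuraParametrizationSplitDegreeProofs.lean`: transport along `Γ₀^1(N) = hΓ₀(N)h⁻¹`,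
Atkin–Lehner multiplicity one, the degree of the Eichler–Shimura map, Faltings), and this file
records the assembly WITHOUT `h0` (`PastenShimura2024_thm_6_1_b_of_ribetTakahashi_treeFacts'`,
remaining hypotheses verbatim), after the small strengthening of the bridge that the printed
argument really gives: `δ^{Sh}_{1,N}` divides the degree of EVERY classical datum with the newform
of the class, minimal or not (`IsMinimalFor.deg_dvd_modularDegree_of_isNewformOf`, through the
unconditional optimal datum `E_f` of the tree).

After this file the discharge `PastenShimura2024_thm_6_1_b_holds` waits exactly for (docstring of
the theorem): the named facts `mazurKenku_exists_cyclic_isogeny`, `mestreOesterle1989_thm_1`,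
`nonempty_shimuraParametrizationData`; the component-group inputs of §6.4/6.6 (Prop. 6.13 =
Ribet–Takahashi Thm. 2, `j_p ∣ #Φ_p`, the Eisenstein divisibility `i_p ∣ r + 1 − a_r`, Lemma 6.7),
which have no vocabulary in the tree (Néron models of `J₀^D(M)`); and the Diophantine Lemmas 6.10
(at `L = 8`, `S ∋ 2`) and 6.12.

## References

* H. Pasten, *Shimura curves and the abc conjecture*, J. Number Theory 254 (2024) 214–335 =
  arXiv:1705.09251, §2 p. 12, Thm. 6.1 p. 20, §6.4–6.9 pp. 22–25 (held arXiv text, read).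
  [PastenShimura2024]
* K. Ribet, S. Takahashi, PNAS 94 (1997) 11110–11114, Thm. 2. [RibetTakahashi1997]
* A. W. Knapp, *Elliptic curves*, Math. Notes 40 (1993), Prop. 12.9 (a), p. 302. [Knapp1993]
* J.-F. Mestre, J. Oesterlé, *Courbes de Weil semi-stables de discriminant une puissance
  m-ième*, J. reine angew. Math. 400 (1989), §4 Théorème 1. [MestreOesterle1989]

## Mathlib / tree search

Tree: `ShimuraParametrizationData.IsMinimalFor.deg_dvd_modularDegree`
(`ShimuraParametrizationSplitDegreeProofs`, landed 2026-08-16),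
`PastenShimura2024_thm_6_1_b_of_ribetTakahashi_treeFacts` (`ShimuraCurveRibetTakahashiCokernelProofs`),
`ModularParametrizationData.exists_optimalDatum'`, `isogenyMap_ker_eq_bot_iff`,
`modularDegree_le_of_isogenyMap_ker_eq_bot`, `modularDegree_eq_card_ker_mul`,
`finite_setOf_natCard_fiberOrbits_ne` (`ModularCurveManinSemistable(Bridge)Proofs`).
`lean search 'treeFacts|deg_dvd_modularDegree'` shows no `h0`-free form of the assembly and only the
`hmin`-carrying divisibility.
-/

noncomputable section

open scoped MatrixGroups ModularForm

namespace Literature.NumberTheory.Automorphic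

open Literature.NumberTheory.EllipticCurves Literature.NumberTheory.EllipticCurves.ModularForms

/-! ### `δ^{Sh}_{1,N}` divides the degree of EVERY classical datum with the newform -/

/-- **`δ^{Sh}_{1,N} ∣ deg φ` for every classical parametrisation `φ` with the newform of the
class** — the tree's `ShimuraParametrizationData.IsMinimalFor.deg_dvd_modularDegree` without the
minimality hypothesis on the classical datum: an optimal datum `D₀` (`c₀Λ_f = Λ_{E₀}`) with the
same newform exists unconditionally (`ModularParametrizationData.exists_optimalDatum'`), it has
minimal degree among all data with that newform (`modularDegree_le_of_isogenyMap_ker_eq_bot`,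
Knapp 1993, Prop. 12.9 (a)), so `deg P ∣ deg φ_{D₀}` by the tree's bridge, and
`deg φ_{D₀} ∣ deg φ_{D₁}` (`deg φ_{D₁} = [Λ_{E₁} : c₁Λ_f] · deg φ_{D₀}`,
`modularDegree_eq_card_ker_mul`). (Pasten §2 p. 12: every parametrisation by `X₀(N)` of a curve of
the class factors through the optimal quotient `q_{1,N} j_N` of degree `δ_{1,N}`.)
[cite: PastenShimura2024, §2 p. 12 (δ_{1,N} = deg q_{1,N} j_N)] [cite: Knapp1993, Prop. 12.9(a) and p. 302] -/
theorem ShimuraParametrizationData.IsMinimalFor.deg_dvd_modularDegree_of_isNewformOf {N : ℕ}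
    [NeZero N] {X : ShimuraCurveData 1 N} {W W' W₁ : WeierstrassCurve ℚ} [W.IsElliptic]
    [W'.IsElliptic] [W₁.IsElliptic] {P : ShimuraParametrizationData X W'} (hP : P.IsMinimalFor W)
    (D₁ : ModularParametrizationData W₁ N) (hf : IsNewformOf W D₁.f) :
    P.deg ∣ D₁.modularDegree := by
  obtain ⟨W₀, hW₀, D₀, hf₀, h₀⟩ := D₁.exists_optimalDatum'
  haveI := hW₀
  have hker : D₀.isogenyMap.ker = ⊥ := D₀.isogenyMap_ker_eq_bot_iff.mpr h₀
  have hmin₀ : ∀ (W₂ : WeierstrassCurve ℚ) [W₂.IsElliptic] (D₂ : ModularParametrizationData W₂ N),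
      D₂.f = D₀.f → D₀.modularDegree ≤ D₂.modularDegree :=
    fun W₂ _ D₂ hD₂ => D₀.modularDegree_le_of_isogenyMap_ker_eq_bot hker D₂ hD₂
  have hf₀' : IsNewformOf W D₀.f := by
    rw [hf₀]
    exact hf
  have h1 : P.deg ∣ D₀.modularDegree := hP.deg_dvd_modularDegree D₀ hf₀' hmin₀
  have hinj₀ : Function.Injective D₀.isogenyMap := (AddMonoidHom.ker_eq_bot_iff _).mp hker
  obtain ⟨-, hdeg⟩ := D₁.modularDegree_eq_card_ker_mul hf₀.symm D₀.smul_periodLattice_le hinj₀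
    D₀.deg_pos D₀.finite_setOf_natCard_fiberOrbits_ne
  exact h1.trans ⟨_, hdeg.trans (mul_comm _ _)⟩

/-! ### The finest assembly of Thm. 6.1 (b), `h0` discharged -/

/-- **Pasten 2024, Thm. 6.1 (b) assembled from the finer printed inputs over the tree's facts,
the `D = 1` bridge discharged** — `PastenShimura2024_thm_6_1_b_of_ribetTakahashi_treeFacts`
(Pasten §6.6–6.9 performed in the tree) with its hypothesis `h0` supplied by the tree's theorem
`ShimuraParametrizationData.IsMinimalFor.deg_dvd_modularDegree` (the conductor and class
hypotheses offered by `h0` are not needed). What the one-line discharge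
`PastenShimura2024_thm_6_1_b_holds` still needs is exactly the remaining hypotheses: the named
facts `hMK` (Mazur 1978 Thm. 1 with Kenku 1982), `hMO` (Mestre–Oesterlé 1989 Thm. 1), `hP`
(Jacquet–Langlands, Pasten §2 p. 12); the component-group quantities `cI = i_p`, `cJ = j_p` of the
optimal quotient `J₀^D(M) → A_{D,M}` with Prop. 6.13 (`h613`, Ribet–Takahashi 1997 Thm. 2),
`j_p ∣ #Φ_p(A) = v_p(Δ)` (`hJc`, p. 24), the Eisenstein divisibility `i_p ∣ r + 1 − a_r` (`hEis`,
proof of Lemma 6.14 p. 23) and Lemma 6.7 (`h67`, Mazur/Ribet/Faltings/Chebotarev, p. 22) — none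
statable without Néron models of `J₀^D(M)`, absent from the tree; and the Diophantine Lemma 6.12
(`h612`, Wiles/Ribet/Darmon–Merel) and Lemma 6.10 at `L = 8`, `S ∋ 2` (`h610`, Darmon–Granville).
[cite: PastenShimura2024, Thm. 6.1 (b) p. 20, §6.4–6.9 pp. 22–25, §2 p. 12 (X₀^1(N) = X₀(N))] [cite: RibetTakahashi1997, Thm. 2] [cite: MestreOesterle1989, §4 Théorème 1 (p. 176)] [cite: Mazur1978, Thm. 1] [cite: Kenku1982] -/
theorem PastenShimura2024_thm_6_1_b_of_ribetTakahashi_treeFacts'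
    (hMK : mazurKenku_exists_cyclic_isogeny) (hMO : mestreOesterle1989_thm_1)
    (hP : nonempty_shimuraParametrizationData)
    (cI cJ : ∀ {D M : ℕ} {X : ShimuraCurveData D M} {W' : WeierstrassCurve ℚ},
      ShimuraParametrizationData X W' → ℕ → ℕ)
    (hI : ∀ {D M : ℕ} {X : ShimuraCurveData D M} {W' : WeierstrassCurve ℚ}
      (P : ShimuraParametrizationData X W') (p : ℕ), 0 < cI P p)
    (hJ : ∀ {D M : ℕ} {X : ShimuraCurveData D M} {W' : WeierstrassCurve ℚ}
      (P : ShimuraParametrizationData X W') (p : ℕ), 0 < cJ P p)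
    (h613 : ∀ {N d M₁ D M p r : ℕ}, p.Prime → r.Prime → p ≠ r → D = d * (p * r) →
      M₁ = p * r * M → IsAdmissibleFactorization N D M →
      ∀ (X₁ : ShimuraCurveData d M₁) (X₂ : ShimuraCurveData D M)
        (W : WeierstrassCurve ℚ) [W.IsElliptic] [W.IsGloballyMinimal], W.conductorNorm ℤ = N →
      ∀ (W₁' : WeierstrassCurve ℚ) [W₁'.IsElliptic] (P₁ : ShimuraParametrizationData X₁ W₁'),
        P₁.IsMinimalFor W →
      ∀ (W₂' : WeierstrassCurve ℚ) [W₂'.IsElliptic] (P₂ : ShimuraParametrizationData X₂ W₂'),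
        P₂.IsMinimalFor W →
        P₁.deg * (cI P₁ p ^ 2 * cJ P₂ r ^ 2) =
          P₂.deg * ((W₁'.minimalDiscriminantNorm ℤ).factorization p *
            (W₂'.minimalDiscriminantNorm ℤ).factorization r))
    (hJc : ∀ {N D M : ℕ}, IsAdmissibleFactorization N D M →
      ∀ (X : ShimuraCurveData D M) (W : WeierstrassCurve ℚ) [W.IsElliptic] [W.IsGloballyMinimal],
        W.conductorNorm ℤ = N →
      ∀ (W' : WeierstrassCurve ℚ) [W'.IsElliptic] (P : ShimuraParametrizationData X W'),
        P.IsMinimalFor W → ∀ p : ℕ, p.Prime → p ∣ D →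
        cJ P p ∣ (W'.minimalDiscriminantNorm ℤ).factorization p)
    {S : Finset ℕ} (h2S : 2 ∈ S)
    (hEis : ∀ {N D M : ℕ}, IsAdmissibleFactorization N D M →
      ∀ (X : ShimuraCurveData D M) (W : WeierstrassCurve ℚ) [W.IsElliptic] [W.IsGloballyMinimal],
        W.conductorNorm ℤ = N →
      ∀ (W' : WeierstrassCurve ℚ) [W'.IsElliptic] (P : ShimuraParametrizationData X W'),
        P.IsMinimalFor W → ∀ p : ℕ, p.Prime → p ∣ M → ¬ p ^ 2 ∣ M →
        ∀ r : ℕ, r.Prime → ¬ r ∣ N → (cI P p : ℤ) ∣ (r + 1 : ℤ) - W'.LFunction r)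
    (h67 : ∀ ℓ : ℕ, ℓ.Prime → ∃ β : ℕ, (163 < ℓ → β = 1) ∧
      ∀ (A : WeierstrassCurve ℚ) [A.IsElliptic],
        (∀ q : ℕ, q.Prime → q ∉ S → ¬ q ^ 2 ∣ A.conductorNorm ℤ) →
        ∀ r₀ : ℕ, ∃ r : ℕ, r₀ < r ∧ r.Prime ∧ ¬ ((ℓ ^ β : ℕ) : ℤ) ∣ (r + 1 : ℤ) - A.LFunction r)
    (h612 : ∀ (W : WeierstrassCurve ℚ) [W.IsElliptic], IsFreyHellegouarch W →
      (∃ q : ℕ, q.Prime ∧ q ≠ 2 ∧ q ∣ W.conductorNorm ℤ) →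
      ∀ ℓ : ℕ, ℓ.Prime → 3 ≤ ℓ → ∀ k : ℕ, ordCompl[2] (W.minimalDiscriminantNorm ℤ) ≠ k ^ ℓ)
    (h610 : {Δ : ℕ | ∃ (W : WeierstrassCurve ℚ) (_ : W.IsElliptic),
        (∀ q : ℕ, q.Prime → q ∉ S → ¬ q ^ 2 ∣ W.conductorNorm ℤ) ∧
        W.minimalDiscriminantNorm ℤ = Δ ∧
        ∃ n k : ℕ, (∀ q : ℕ, q.Prime → q ∣ n → q ∈ S) ∧ Δ = n * k ^ 8}.Finite) :
    PastenShimura2024_thm_6_1_b :=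
  PastenShimura2024_thm_6_1_b_of_ribetTakahashi_treeFacts hMK hMO hP
    (fun _X _W _ _ _hN _hcl _W₁ _ D₁ hf hmin _W' _ _P hP => hP.deg_dvd_modularDegree D₁ hf hmin)
    cI cJ hI hJ h613 hJc h2S hEis h67 h612 h610

end Literature.NumberTheory.Automorphic

end
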